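import Literature.ModelTheory.ExponentialFields.DefinableCompleteness
import Mathlib.Topology.Baire.Lemmas
import Mathlib.Topology.Baire.CompleteMetrizable
import Mathlib.Topology.GDelta.Basic
import Mathlib.Topology.Order.DenselyOrdered
import Mathlib.Topology.Instances.Real.Lemmas
import HarnessLib

/-!
# Definably Baire structures and the first-order axiom scheme `[DCB]` (Baire half)

Topic `Literature/ModelTheory/ExponentialFields`.  A. Fornasiero – T. Servi, *Definably complete
Baire structures*, Fund. Math. 209 (2010), Def. 2.1–2.2 and Def. 2.9, and P. Hieronymi, *An
analogue of the Baire category theorem*, J. Symbolic Logic 78 (2013), Theorem A ("We say that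
`K` is definably Baire if it satisfies the conclusion of Theorem A"): an expansion `M` of an
ordered structure is *definably Baire* if no increasing family `(Y_t)_{t ∈ M}` of nowhere dense
subsets of `M` which is definable (with parameters, as a subset `Y ⊆ M²`) covers `M`.  With the
definable completeness scheme `[DC]` (`DefinableCompleteness.lean`) this is the scheme `[DCB]`
of the recursively axiomatized subtheories `T ⊆ Th(ℝ_exp)`-like used in Macintyre–Wilkie-style
decidability proofs (Jones–Servi, J. Symbolic Logic 76 (2011), Def. 1.2: "[DCB] Axioms of
definably complete Baire structure"; Fornasiero–Servi 2010, Remark 2.10: "The fact that `K` is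
Baire can be expressed by a set of first-order sentences … If moreover the language is
recursive, this set of sentences is also recursive"; Cor. 8.3: ordered field + `[DCB]` +
`exp' = exp` axiomatize a recursive subtheory of `Th(ℝ_exp)` which is o-minimal).

## Contents (everything proved; no named facts)

* `FirstOrder.Language.IsDefinablyBaire L M` — the notion (a predicate, in the style of
  `IsDefinablyComplete`); `isDefinablyBaire_real` (every structure on `ℝ`, by the Baire
  category theorem);
* `DefinableBaire.swapAt m φ` — the formula `φ` with the variables `&m` and `&(m+1)` exchanged
  (a `mapTermRel`), `realize_swapAt`;
* for `φ : L.BoundedFormula Empty (m + 2)` (parameters `&0, …, &(m-1)`, point `&m`, index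
  `&(m+1)`, defining the family `Y_t = {x | φ(ȳ, x, t)}`): `cov φ`, `inc φ`, `cl ψ`, `nd ψ` and
  the instance `DefinableBaire.sentence φ` of the scheme — "for all `ȳ`: if the family covers
  `M` and is increasing then some `Y_t` is somewhere dense" — with their semantics
  (`realize_cov`, `realize_inc`, `realize_cl`, `realize_nd`, `realize_sentence`);
* `DefinableBaire.scheme L : L.Theory`; `model_scheme_iff`, and
  **`model_scheme_iff_isDefinablyBaire`** (on a dense linear order without endpoints with its
  order topology: a structure is a model of the scheme iff it is definably Baire);
* for `ℝ_exp`: `Real.model_definableBaireScheme`, `DefinableBaire.scheme_subset_realExpTheory`.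

What is NOT here: the recursiveness of the scheme (arithmetization, a separate file) and
Hieronymi's theorem (definably complete expansions of ordered fields are definably Baire).

## References

* A. Fornasiero, T. Servi, *Definably complete Baire structures*, Fund. Math. 209 (2010)
  215–241, Def. 2.1, 2.2, 2.9, Remark 2.10, Examples 2.11, Cor. 8.3. [FornasieroServi2010]
* P. Hieronymi, *An analogue of the Baire category theorem*, J. Symbolic Logic 78 (2013)
  207–213, Theorem A. [Hieronymi2013]
* G. O. Jones, T. Servi, *On the decidability of the real field with a generic power function*,
  J. Symbolic Logic 76 (2011) 1418–1428, Def. 1.2. [JonesServi2011]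
-/

universe u v w

open Set FirstOrder FirstOrder.Language FirstOrder.Language.BoundedFormula
open _root_.Filter _root_.Topology

namespace FirstOrder.Language

/-- **Definably Baire structure** (Fornasiero–Servi 2010, Def. 2.1–2.2 and 2.9; Hieronymi 2013,
Theorem A): no increasing family `(Y_t)_{t ∈ M}` of nowhere dense subsets of `M`, definable
with parameters as the set `Y = {(t, x) | x ∈ Y_t} ⊆ M²`, covers `M`.  A deliberate
dot-notation extension of Mathlib's namespace `FirstOrder.Language`, like `IsDefinablyComplete`.
[cite: FornasieroServi2010, Def. 2.9] -/
def IsDefinablyBaire (L : Language.{u, v}) (M : Type w) [L.Structure M] [TopologicalSpace M]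
    [LE M] : Prop :=
  ∀ Y : Set (Fin 2 → M), (univ : Set M).Definable L Y →
    (∀ t, IsNowhereDense {x | (![t, x] : Fin 2 → M) ∈ Y}) →
      (∀ s t, s ≤ t → {x | (![s, x] : Fin 2 → M) ∈ Y} ⊆ {x | (![t, x] : Fin 2 → M) ∈ Y}) →
        ∃ x, ∀ t, (![t, x] : Fin 2 → M) ∉ Y

variable {L : Language.{u, v}} {M : Type w} [L.Structure M]

/-- Unfolding lemma. [folklore] -/
theorem isDefinablyBaire_iff [TopologicalSpace M] [LE M] : L.IsDefinablyBaire M ↔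
    ∀ Y : Set (Fin 2 → M), (univ : Set M).Definable L Y →
      (∀ t, IsNowhereDense {x | (![t, x] : Fin 2 → M) ∈ Y}) →
        (∀ s t, s ≤ t → {x | (![s, x] : Fin 2 → M) ∈ Y} ⊆ {x | (![t, x] : Fin 2 → M) ∈ Y}) →
          ∃ x, ∀ t, (![t, x] : Fin 2 → M) ∉ Y := Iff.rfl

/-- **Every structure on `ℝ` is definably Baire** (Fornasiero–Servi 2010, Examples 2.11: "Every
expansion of `ℝ` (because `ℝ` is Dedekind complete and topologically Baire)"): if an increasing
family `(Y_t)_{t ∈ ℝ}` of nowhere dense sets covered `ℝ`, the closures of the `Y_n`, `n ∈ ℕ`,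
would be countably many closed sets with empty interiors covering `ℝ`, against the Baire
category theorem. [cite: FornasieroServi2010, Examples 2.11] -/
theorem isDefinablyBaire_real (L : Language.{u, v}) [L.Structure ℝ] : L.IsDefinablyBaire ℝ := by
  intro Y _ hnd hinc
  by_contra hcov
  push Not at hcov
  have hU : ⋃ n : ℕ, closure {x : ℝ | (![(n : ℝ), x] : Fin 2 → ℝ) ∈ Y} = univ := by
    refine eq_univ_of_forall fun x => ?_
    obtain ⟨t, ht⟩ := hcov x
    exact mem_iUnion.2 ⟨⌈t⌉₊, subset_closure (hinc t _ (Nat.le_ceil t) ht)⟩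
  obtain ⟨n, hn⟩ := nonempty_interior_of_iUnion_of_closed (fun n => isClosed_closure) hU
  have h := hnd n
  rw [IsNowhereDense] at h
  rw [h] at hn
  exact Set.not_nonempty_empty hn

end FirstOrder.Language

namespace Literature.ModelTheory.ExponentialFields

namespace DefinableBaire

variable {L : Language.{u, v}} {M : Type w} [L.Structure M] {m : ℕ}

/-! ### Exchanging two variables -/

/-- The transposition of the levels `m` and `m + 1` of `Fin k` (the identity if `m + 1 ≥ k`).
[folklore] -/
def swapFin (m k : ℕ) (i : Fin k) : Fin k :=
  if h : m + 1 < k then Equiv.swap (⟨m, (Nat.lt_succ_self m).trans h⟩ : Fin k) ⟨m + 1, h⟩ i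
  else i

/-- `swapFin` as a transposition when `m + 1 < k`. [folklore] -/
theorem swapFin_of_lt {m k : ℕ} (h : m + 1 < k) (i : Fin k) :
    swapFin m k i = Equiv.swap (⟨m, (Nat.lt_succ_self m).trans h⟩ : Fin k) ⟨m + 1, h⟩ i := by
  simp [swapFin, h]

/-- The value of `swapFin m k i`. [folklore] -/
theorem swapFin_val {m k : ℕ} (h : m + 1 < k) (i : Fin k) :
    (swapFin m k i).val = if i.val = m then m + 1 else if i.val = m + 1 then m else i.val := by
  rw [swapFin_of_lt h, Equiv.swap_apply_def]
  by_cases h1 : i.val = m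
  · have : i = ⟨m, (Nat.lt_succ_self m).trans h⟩ := Fin.ext h1
    subst this
    simp
  · have hne : i ≠ ⟨m, (Nat.lt_succ_self m).trans h⟩ := fun e => h1 (congrArg Fin.val e)
    by_cases h2 : i.val = m + 1
    · have : i = ⟨m + 1, h⟩ := Fin.ext h2
      subst this
      simp
    · have hne' : i ≠ ⟨m + 1, h⟩ := fun e => h2 (congrArg Fin.val e)
      simp [hne, hne', h1, h2]

/-- `swapFin` on `Fin (k + 1)` restricted to `Fin k` is `swapFin` on `Fin k`, and it fixes the
last element, when `m + 1 < k`. [folklore] -/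
theorem swapFin_castSucc {m k : ℕ} (h : m + 1 < k) (i : Fin k) :
    swapFin m (k + 1) (Fin.castSucc i) = Fin.castSucc (swapFin m k i) := by
  apply Fin.ext
  rw [Fin.val_castSucc, swapFin_val (Nat.lt_succ_of_lt h), swapFin_val h, Fin.val_castSucc]

/-- `swapFin m (k + 1)` fixes the last element when `m + 1 < k`. [folklore] -/
theorem swapFin_last {m k : ℕ} (h : m + 1 < k) : swapFin m (k + 1) (Fin.last k) = Fin.last k := by
  apply Fin.ext
  rw [swapFin_val (Nat.lt_succ_of_lt h), Fin.val_last]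
  have h1 : k ≠ m := by omega
  have h2 : k ≠ m + 1 := by omega
  simp [h1, h2]

/-- Exchanging two levels below the last commutes with `Fin.snoc`. [folklore] -/
theorem snoc_comp_swapFin {m k : ℕ} (h : m + 1 < k) (xs : Fin k → M) (a : M) :
    (Fin.snoc xs a : Fin (k + 1) → M) ∘ swapFin m (k + 1) = Fin.snoc (xs ∘ swapFin m k) a := by
  funext i
  refine Fin.lastCases ?_ (fun j => ?_) i
  · simp [swapFin_last h]
  · simp [swapFin_castSucc h]

variable (L) in
/-- **The formula `φ` with the variables `&m` and `&(m+1)` exchanged** (at every depth; a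
`mapTermRel` relabelling the variables of all terms). [folklore] -/
def swapAt (m : ℕ) {k : ℕ} (φ : L.BoundedFormula Empty k) : L.BoundedFormula Empty k :=
  φ.mapTermRel (g := id) (fun k t => t.relabel (Sum.map id (swapFin m k))) (fun _ => id)
    fun _ => id

/-- `swapAt` on `⊥`. [folklore] -/
@[simp] theorem swapAt_falsum (m : ℕ) {k : ℕ} :
    swapAt L m (falsum : L.BoundedFormula Empty k) = falsum := rfl

/-- `swapAt` on an equation. [folklore] -/
@[simp] theorem swapAt_equal (m : ℕ) {k : ℕ} (t₁ t₂ : L.Term (Empty ⊕ Fin k)) :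
    swapAt L m (equal t₁ t₂) =
      equal (t₁.relabel (Sum.map id (swapFin m k))) (t₂.relabel (Sum.map id (swapFin m k))) := rfl

/-- `swapAt` on an atomic relation. [folklore] -/
@[simp] theorem swapAt_rel (m : ℕ) {k n : ℕ} (R : L.Relations n) (ts : Fin n → L.Term (Empty ⊕ Fin k)) :
    swapAt L m (rel R ts) = rel R fun i => (ts i).relabel (Sum.map id (swapFin m k)) := rfl

/-- `swapAt` on an implication. [folklore] -/
@[simp] theorem swapAt_imp (m : ℕ) {k : ℕ} (φ ψ : L.BoundedFormula Empty k) :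
    swapAt L m (φ.imp ψ) = (swapAt L m φ).imp (swapAt L m ψ) := rfl

/-- `swapAt` on a universal formula. [folklore] -/
@[simp] theorem swapAt_all (m : ℕ) {k : ℕ} (φ : L.BoundedFormula Empty (k + 1)) :
    swapAt L m φ.all = (swapAt L m φ).all := rfl

/-- **Semantics of `swapAt`**: evaluating `swapAt m φ` at `xs` evaluates `φ` at `xs` with the
entries `m`, `m + 1` exchanged (for `m + 1 < k`). [folklore] -/
theorem realize_swapAt {m k : ℕ} (h : m + 1 < k) (φ : L.BoundedFormula Empty k)
    (xs : Fin k → M) :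
    (swapAt L m φ).Realize default xs ↔ φ.Realize default (xs ∘ swapFin m k) := by
  induction φ with
  | falsum => exact Iff.rfl
  | equal t₁ t₂ =>
      simp only [swapAt_equal, BoundedFormula.Realize, Term.realize_relabel, Sum.elim_comp_map,
        Function.comp_id]
  | rel R ts =>
      simp only [swapAt_rel, BoundedFormula.Realize, Term.realize_relabel, Sum.elim_comp_map,
        Function.comp_id]
  | imp φ ψ ihφ ihψ =>
      simp only [swapAt_imp, BoundedFormula.realize_imp]
      rw [ihφ h xs, ihψ h xs]
  | all φ ih =>
      simp only [swapAt_all, BoundedFormula.realize_all]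
      refine forall_congr' fun a => ?_
      rw [ih (Nat.lt_succ_of_lt h) (Fin.snoc xs a), snoc_comp_swapFin h]

/-- In particular, for `φ(ȳ, x, t)` (`x = &m`, `t = &(m+1)`): `swapAt m φ` evaluated at
`(ȳ, t, x)` is `φ` evaluated at `(ȳ, x, t)`. [folklore] -/
theorem realize_swapAt_snoc_snoc (φ : L.BoundedFormula Empty (m + 2)) (ys : Fin m → M)
    (t x : M) :
    (swapAt L m φ).Realize default (Fin.snoc (Fin.snoc ys t : Fin (m + 1) → M) x) ↔
      φ.Realize default (Fin.snoc (Fin.snoc ys x : Fin (m + 1) → M) t) := by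
  rw [realize_swapAt (by omega)]
  refine Iff.of_eq (congrArg _ ?_)
  funext i
  have hval := swapFin_val (show m + 1 < m + 2 by omega) i
  simp only [Function.comp_apply]
  refine Fin.lastCases ?_ (fun j => ?_) i
  · -- `i = last (m+1)` (the `t`-slot) is sent to `m` (the `x`-slot of the swapped tuple? no: to level `m`)
    have : swapFin m (m + 2) (Fin.last (m + 1)) = (Fin.last m).castSucc := by
      apply Fin.ext; rw [swapFin_val (by omega)]; simp
    rw [this]; simp
  · refine Fin.lastCases ?_ (fun j' => ?_) j
    · have : swapFin m (m + 2) (Fin.last m).castSucc = Fin.last (m + 1) := by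
        apply Fin.ext; rw [swapFin_val (by omega)]; simp
      rw [this]; simp
    · have : swapFin m (m + 2) j'.castSucc.castSucc = j'.castSucc.castSucc := by
        apply Fin.ext; rw [swapFin_val (by omega)]
        have h1 : (j' : ℕ) ≠ m := by omega
        have h2 : (j' : ℕ) ≠ m + 1 := by omega
        simp [h1, h2]
      rw [this]; simp

/-! ### Variable bookkeeping for `liftAt 1 (m + 1)` -/

/-- Dropping the level `m + 1` from a tuple `snoc zs c` whose last level is above `m + 1`: the
last entry stays last. [folklore] -/
theorem snoc_comp_dropLevel {k : ℕ} (hk : m + 1 ≤ k) (zs : Fin (k + 1) → M) (c : M) :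
    ((Fin.snoc zs c : Fin (k + 2) → M) ∘ fun i : Fin (k + 1) =>
        if (i : ℕ) < m + 1 then i.castSucc else i.succ) =
      Fin.snoc (zs ∘ fun i : Fin k => if (i : ℕ) < m + 1 then i.castSucc else i.succ) c := by
  funext i
  refine Fin.lastCases ?_ (fun j => ?_) i
  · have h : ¬ ((Fin.last k : Fin (k + 1)) : ℕ) < m + 1 := by rw [Fin.val_last]; omega
    simp only [Function.comp_apply, h, if_false, Fin.succ_last, Fin.snoc_last]
  · by_cases hj : (j : ℕ) < m + 1
    · simp only [Function.comp_apply, Fin.val_castSucc, hj, if_true, Fin.snoc_castSucc]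
    · simp only [Function.comp_apply, Fin.val_castSucc, hj, if_false, Fin.succ_castSucc,
        Fin.snoc_castSucc]

/-- Dropping the last level `m + 1` from a tuple of length `m + 2`. [folklore] -/
theorem snoc_comp_dropLevel_self (zs : Fin (m + 1) → M) (c : M) :
    ((Fin.snoc zs c : Fin (m + 2) → M) ∘ fun i : Fin (m + 1) =>
        if (i : ℕ) < m + 1 then i.castSucc else i.succ) = zs := by
  funext i
  have hi : (i : ℕ) < m + 1 := i.isLt
  simp only [Function.comp_apply, hi, if_true, Fin.snoc_castSucc]

/-! ### The instance of the scheme at a formula `φ(ȳ, x, t)` -/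

section Scheme

/-- For `φ(ȳ, x, t)` (`φ : L.BoundedFormula Empty (m + 2)`: parameters `&0, …, &(m-1)`, point
`x = &m`, index `t = &(m+1)`): the formula `cov_φ(ȳ) := ∀ x ∃ t φ(ȳ, x, t)` — "the family
`Y_t = {x | φ(ȳ, x, t)}` covers the line". [folklore] -/
def cov (φ : L.BoundedFormula Empty (m + 2)) : L.BoundedFormula Empty m :=
  ∀' ∃' φ

/-- `ψ(ȳ, t, x)` with three dummy variables inserted after `t`: at `(ȳ, t, x, u, v, y)` it reads
`ψ(ȳ, t, y)`. [folklore] -/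
def lift3 (ψ : L.BoundedFormula Empty (m + 2)) : L.BoundedFormula Empty (m + 5) :=
  ((ψ.liftAt 1 (m + 1)).liftAt 1 (m + 1)).liftAt 1 (m + 1)

/-- `χ(ȳ, t, x)` with two dummy variables inserted after `t`: at `(ȳ, t, c, d, x)` it reads
`χ(ȳ, t, x)`. [folklore] -/
def lift2 (χ : L.BoundedFormula Empty (m + 2)) : L.BoundedFormula Empty (m + 4) :=
  (χ.liftAt 1 (m + 1)).liftAt 1 (m + 1)

variable [L.IsOrdered]

/-- For `φ(ȳ, x, t)`: the formula `inc_φ(ȳ) := ∀ x ∀ a ∀ b (a ≤ b → φ(ȳ, x, a) → φ(ȳ, x, b))` —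
"the family is increasing". [folklore] -/
def inc (φ : L.BoundedFormula Empty (m + 2)) : L.BoundedFormula Empty m :=
  ∀' ∀' ∀' ((var (Sum.inr (Fin.last (m + 1)).castSucc)).le (var (Sum.inr (Fin.last (m + 2)))) ⟹
    (φ.liftAt 1 (m + 2) ⟹ φ.liftAt 1 (m + 1)))

/-- The antecedent `u < x ∧ x < v` of `cl`, in the variables `(ȳ, t, x, u, v)`. [folklore] -/
def clAnte (m : ℕ) : L.BoundedFormula Empty (m + 4) :=
  (var (Sum.inr (Fin.last (m + 2)).castSucc)).lt (var (Sum.inr (Fin.last (m + 1)).castSucc.castSucc)) ⊓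
    (var (Sum.inr (Fin.last (m + 1)).castSucc.castSucc)).lt (var (Sum.inr (Fin.last (m + 3))))

/-- The body `u < y ∧ y < v ∧ ψ(ȳ, t, y)` of `cl`, in the variables `(ȳ, t, x, u, v, y)`.
[folklore] -/
def clBody (ψ : L.BoundedFormula Empty (m + 2)) : L.BoundedFormula Empty (m + 5) :=
  ((var (Sum.inr (Fin.last (m + 2)).castSucc.castSucc)).lt (var (Sum.inr (Fin.last (m + 4)))) ⊓
    (var (Sum.inr (Fin.last (m + 4)))).lt (var (Sum.inr (Fin.last (m + 3)).castSucc))) ⊓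
    lift3 ψ

/-- For `ψ(ȳ, t, x)` (`t = &m`, `x = &(m+1)`): the formula
`cl_ψ(ȳ, t, x) := ∀ u ∀ v (u < x ∧ x < v → ∃ y (u < y ∧ y < v ∧ ψ(ȳ, t, y)))` — "`x` lies in the
closure of `{y | ψ(ȳ, t, y)}`" (for the order topology). [folklore] -/
def cl (ψ : L.BoundedFormula Empty (m + 2)) : L.BoundedFormula Empty (m + 2) :=
  ∀' ∀' (clAnte m ⟹ ∃' (clBody ψ))

/-- The antecedent `c < d` of `nd`, in the variables `(ȳ, t, c, d)`. [folklore] -/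
def ndAnte (m : ℕ) : L.BoundedFormula Empty (m + 3) :=
  (var (Sum.inr (Fin.last (m + 1)).castSucc)).lt (var (Sum.inr (Fin.last (m + 2))))

/-- The body `c < x ∧ x < d ∧ ¬ cl_ψ(ȳ, t, x)` of `nd`, in the variables `(ȳ, t, c, d, x)`.
[folklore] -/
def ndBody (ψ : L.BoundedFormula Empty (m + 2)) : L.BoundedFormula Empty (m + 4) :=
  ((var (Sum.inr (Fin.last (m + 1)).castSucc.castSucc)).lt (var (Sum.inr (Fin.last (m + 3)))) ⊓
    (var (Sum.inr (Fin.last (m + 3)))).lt (var (Sum.inr (Fin.last (m + 2)).castSucc))) ⊓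
    ∼(lift2 (cl ψ))

/-- For `ψ(ȳ, t, x)`: the formula
`nd_ψ(ȳ) := ∀ t ∀ c ∀ d (c < d → ∃ x (c < x ∧ x < d ∧ ¬ cl_ψ(ȳ, t, x)))` — "every
`{x | ψ(ȳ, t, x)}` is nowhere dense" (every open interval has a point off its closure).
[folklore] -/
def nd (ψ : L.BoundedFormula Empty (m + 2)) : L.BoundedFormula Empty m :=
  ∀' ∀' ∀' (ndAnte m ⟹ ∃' (ndBody ψ))

/-- **The instance of the Baire scheme at `φ(ȳ, x, t)`**: the sentence
`∀ ȳ (cov_φ(ȳ) → inc_φ(ȳ) → ¬ nd_{φˢ}(ȳ))` with `φˢ = swapAt m φ` (the same family, indexed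
first) — "for all `ȳ`: if the increasing definable family `Y_t = {x | φ(ȳ, x, t)}` covers the
line then some `Y_t` is somewhere dense" (Fornasiero–Servi 2010, Def. 2.1–2.2, 2.9 and
Remark 2.10; Hieronymi 2013, Theorem A).  The antecedent `cov_φ` comes first so that the letters
of `φ` form a prefix of the instance (used by the recogniser of the scheme). [cite: FornasieroServi2010, Def. 2.9] -/
def sentence (φ : L.BoundedFormula Empty (m + 2)) : L.Sentence :=
  (cov φ ⟹ (inc φ ⟹ ∼(nd (swapAt L m φ)))).alls

variable (L) in
/-- **The Baire scheme** of an ordered language `L` (the Baire half of `[DCB]`): the set of the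
sentences `sentence φ`, `φ(ȳ, x, t)` ranging over all `L`-formulas with any number `m` of
parameter variables. [cite: FornasieroServi2010, Def. 2.9] -/
def scheme : L.Theory :=
  {σ | ∃ (m : ℕ) (φ : L.BoundedFormula Empty (m + 2)), sentence φ = σ}

/-- Each instance belongs to the scheme. [folklore] -/
theorem sentence_mem_scheme (φ : L.BoundedFormula Empty (m + 2)) : sentence φ ∈ scheme L :=
  ⟨m, φ, rfl⟩

/-! ### Semantics -/

omit [L.IsOrdered] in
/-- Semantics of `cov`. [folklore] -/
theorem realize_cov (φ : L.BoundedFormula Empty (m + 2)) (ys : Fin m → M) :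
    (cov φ).Realize default ys ↔
      ∀ x, ∃ t, φ.Realize default (Fin.snoc (Fin.snoc ys x : Fin (m + 1) → M) t) := by
  simp only [cov, realize_all, realize_ex]

/-- Semantics of `inc`. [folklore] -/
theorem realize_inc [LE M] [L.OrderedStructure M] (φ : L.BoundedFormula Empty (m + 2))
    (ys : Fin m → M) :
    (inc φ).Realize default ys ↔ ∀ x a b, a ≤ b →
      φ.Realize default (Fin.snoc (Fin.snoc ys x : Fin (m + 1) → M) a) →
        φ.Realize default (Fin.snoc (Fin.snoc ys x : Fin (m + 1) → M) b) := by
  simp only [inc, realize_all, realize_imp, Term.realize_le, Term.realize_var, Sum.elim_inr,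
    Fin.snoc_last, Fin.snoc_castSucc, realize_liftAt_one_self, Fin.snoc_comp_castSucc]
  refine forall_congr' fun x => forall_congr' fun a => forall_congr' fun b => ?_
  rw [realize_liftAt_one (by omega : m + 1 ≤ m + 2), snoc_comp_dropLevel (m := m) (k := m + 1) le_rfl,
    snoc_comp_dropLevel_self]

/-- Semantics of `cl`: `cl_ψ(ȳ, t, x)` says that every open interval around `x` meets
`{y | ψ(ȳ, t, y)}`. [folklore] -/
theorem realize_cl [Preorder M] [L.OrderedStructure M] (ψ : L.BoundedFormula Empty (m + 2))
    (ys : Fin m → M) (t x : M) :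
    (cl ψ).Realize default (Fin.snoc (Fin.snoc ys t : Fin (m + 1) → M) x) ↔
      ∀ u v, u < x → x < v → ∃ y, u < y ∧ y < v ∧
        ψ.Realize default (Fin.snoc (Fin.snoc ys t : Fin (m + 1) → M) y) := by
  simp only [cl, clAnte, clBody, lift3, realize_all, realize_imp, realize_ex, realize_inf,
    Term.realize_lt, Term.realize_var, Sum.elim_inr, Fin.snoc_last, Fin.snoc_castSucc]
  refine forall_congr' fun u => forall_congr' fun v => ?_
  rw [and_imp]
  refine imp_congr_right fun _ => imp_congr_right fun _ => exists_congr fun y => ?_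
  rw [realize_liftAt_one (by omega : m + 1 ≤ m + 4), realize_liftAt_one (by omega : m + 1 ≤ m + 3),
    realize_liftAt_one (by omega : m + 1 ≤ m + 2)]
  simp only [snoc_comp_dropLevel (m := m) (k := m + 3) (by omega),
    snoc_comp_dropLevel (m := m) (k := m + 2) (by omega),
    snoc_comp_dropLevel (m := m) (k := m + 1) le_rfl, snoc_comp_dropLevel_self, and_assoc]

/-- Semantics of `nd`: `nd_ψ(ȳ)` says that for every `t`, every open interval contains a point
off the "closure" `{x | cl_ψ(ȳ, t, x)}`. [folklore] -/
theorem realize_nd [Preorder M] [L.OrderedStructure M] (ψ : L.BoundedFormula Empty (m + 2))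
    (ys : Fin m → M) :
    (nd ψ).Realize default ys ↔ ∀ t c d, c < d → ∃ x, c < x ∧ x < d ∧
      ¬ (cl ψ).Realize default (Fin.snoc (Fin.snoc ys t : Fin (m + 1) → M) x) := by
  simp only [nd, ndAnte, ndBody, lift2, realize_all, realize_imp, realize_ex, realize_inf,
    realize_not, Term.realize_lt, Term.realize_var, Sum.elim_inr, Fin.snoc_last, Fin.snoc_castSucc]
  refine forall_congr' fun t => forall_congr' fun c => forall_congr' fun d => imp_congr_right
    fun _ => exists_congr fun x => ?_
  rw [realize_liftAt_one (by omega : m + 1 ≤ m + 3), realize_liftAt_one (by omega : m + 1 ≤ m + 2)]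
  simp only [snoc_comp_dropLevel (m := m) (k := m + 2) (by omega),
    snoc_comp_dropLevel (m := m) (k := m + 1) le_rfl, snoc_comp_dropLevel_self, and_assoc]

/-- Semantics of the instance `sentence φ` (raw form). [cite: FornasieroServi2010, Def. 2.9] -/
theorem realize_sentence [Preorder M] [L.OrderedStructure M] (φ : L.BoundedFormula Empty (m + 2)) :
    M ⊨ sentence φ ↔ ∀ ys : Fin m → M,
      (∀ x, ∃ t, φ.Realize default (Fin.snoc (Fin.snoc ys x : Fin (m + 1) → M) t)) →
        (∀ x a b, a ≤ b → φ.Realize default (Fin.snoc (Fin.snoc ys x : Fin (m + 1) → M) a) →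
          φ.Realize default (Fin.snoc (Fin.snoc ys x : Fin (m + 1) → M) b)) →
          ¬ ∀ t c d, c < d → ∃ x, c < x ∧ x < d ∧
            ¬ (cl (swapAt L m φ)).Realize default (Fin.snoc (Fin.snoc ys t : Fin (m + 1) → M) x) := by
  simp only [sentence, Sentence.Realize, realize_alls, realize_imp, realize_not, realize_cov,
    realize_inc, realize_nd]

end Scheme

/-! ### Closures and nowhere density through open intervals -/

section Topology

variable [LinearOrder M] [DenselyOrdered M] [NoMinOrder M] [NoMaxOrder M] [TopologicalSpace M]
  [OrderTopology M]

omit [L.Structure M] [DenselyOrdered M] in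
/-- On a dense linear order without endpoints with its order topology: `x ∈ closure S` iff every
open interval around `x` meets `S`. [folklore] -/
theorem mem_closure_iff_forall_Ioo {S : Set M} {x : M} :
    x ∈ closure S ↔ ∀ u v, u < x → x < v → ∃ y, u < y ∧ y < v ∧ y ∈ S := by
  rw [mem_closure_iff_nhds]
  constructor
  · intro h u v hu hv
    obtain ⟨y, hyI, hyS⟩ := h (Ioo u v) (Ioo_mem_nhds hu hv)
    exact ⟨y, hyI.1, hyI.2, hyS⟩
  · intro h U hU
    obtain ⟨l, r, ⟨hl, hr⟩, hsub⟩ := mem_nhds_iff_exists_Ioo_subset.1 hU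
    obtain ⟨y, hly, hyr, hyS⟩ := h l r hl hr
    exact ⟨y, hsub ⟨hly, hyr⟩, hyS⟩

omit [L.Structure M] in
/-- On a dense linear order without endpoints with its order topology: `S` is nowhere dense iff
every open interval `(c, d)`, `c < d`, contains a point off the closure of `S`. [folklore] -/
theorem isNowhereDense_iff_forall_Ioo {S : Set M} :
    IsNowhereDense S ↔ ∀ c d, c < d → ∃ x, c < x ∧ x < d ∧ x ∉ closure S := by
  rw [IsNowhereDense]
  constructor
  · intro h c d hcd
    by_contra hne
    push Not at hne
    have hsub : Ioo c d ⊆ interior (closure S) :=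
      interior_maximal (fun x hx => hne x hx.1 hx.2) isOpen_Ioo
    obtain ⟨x, hx⟩ := exists_between hcd
    have hx' := hsub hx
    rw [h] at hx'
    exact hx'
  · intro h
    by_contra hne
    obtain ⟨x, hx⟩ := nonempty_iff_ne_empty.2 hne
    obtain ⟨l, r, ⟨hl, hr⟩, hsub⟩ :=
      mem_nhds_iff_exists_Ioo_subset.1 (mem_interior_iff_mem_nhds.1 hx)
    obtain ⟨y, hly, hyr, hy⟩ := h l r (hl.trans hr)
    exact hy (hsub ⟨hly, hyr⟩)

variable [L.IsOrdered] [L.OrderedStructure M]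

omit [DenselyOrdered M] in
/-- `cl_ψ(ȳ, t, x)` holds iff `x` lies in the closure of `{y | ψ(ȳ, t, y)}`. [folklore] -/
theorem realize_cl_iff_mem_closure (ψ : L.BoundedFormula Empty (m + 2)) (ys : Fin m → M)
    (t x : M) :
    (cl ψ).Realize default (Fin.snoc (Fin.snoc ys t : Fin (m + 1) → M) x) ↔
      x ∈ closure {y | ψ.Realize default (Fin.snoc (Fin.snoc ys t : Fin (m + 1) → M) y)} := by
  rw [realize_cl, mem_closure_iff_forall_Ioo]
  rfl

/-- **Semantics of the instance `sentence φ`**: for all `ȳ`, if the family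
`Y_t = {x | φ(ȳ, x, t)}` covers `M` and is increasing, then some `Y_t` is not nowhere dense.
[cite: FornasieroServi2010, Def. 2.9] -/
theorem realize_sentence_iff (φ : L.BoundedFormula Empty (m + 2)) :
    M ⊨ sentence φ ↔ ∀ ys : Fin m → M,
      (∀ x, ∃ t, φ.Realize default (Fin.snoc (Fin.snoc ys x : Fin (m + 1) → M) t)) →
        (∀ x a b, a ≤ b → φ.Realize default (Fin.snoc (Fin.snoc ys x : Fin (m + 1) → M) a) →
          φ.Realize default (Fin.snoc (Fin.snoc ys x : Fin (m + 1) → M) b)) →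
          ∃ t, ¬ IsNowhereDense {x | φ.Realize default (Fin.snoc (Fin.snoc ys x : Fin (m + 1) → M) t)} := by
  rw [realize_sentence]
  refine forall_congr' fun ys => imp_congr_right fun _ => imp_congr_right fun _ => ?_
  rw [not_forall]
  refine exists_congr fun t => ?_
  rw [isNowhereDense_iff_forall_Ioo]
  simp only [realize_cl_iff_mem_closure, realize_swapAt_snoc_snoc]

end Topology

/-! ### Models of the scheme are exactly the definably Baire structures -/

section Models

variable [L.IsOrdered] [LinearOrder M] [DenselyOrdered M] [NoMinOrder M] [NoMaxOrder M]
  [TopologicalSpace M] [OrderTopology M] [L.OrderedStructure M]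

omit [L.IsOrdered] [LinearOrder M] [DenselyOrdered M] [NoMinOrder M] [NoMaxOrder M]
  [TopologicalSpace M] [OrderTopology M] [L.OrderedStructure M] in
/-- The family defined by `φ(ȳ, x, t)` at `ȳ`, as a subset of `M²` in the shape used by
`IsDefinablyBaire` (`{v | φ(ȳ, v 1, v 0)}`, whose fibre at `t` is `{x | φ(ȳ, x, t)}`), is
definable with parameters. [folklore] -/
theorem definable_setOf_realize_snoc_snoc (φ : L.BoundedFormula Empty (m + 2)) (ys : Fin m → M) :
    (univ : Set M).Definable L {v : Fin 2 → M |
      φ.Realize default (Fin.snoc (Fin.snoc ys (v 1) : Fin (m + 1) → M) (v 0))} := by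
  rw [Set.definable_iff_exists_formula_sum]
  refine ⟨φ.toFormula.relabel (Sum.elim Empty.elim
    (Fin.lastCases (Sum.inr 0)
      (Fin.lastCases (Sum.inr 1) fun i => Sum.inl ⟨ys i, Set.mem_univ _⟩))), ?_⟩
  ext v
  simp only [Set.mem_setOf_eq, Formula.realize_relabel, BoundedFormula.realize_toFormula]
  refine Iff.of_eq (congrArg₂ (BoundedFormula.Realize φ) (Subsingleton.elim _ _) ?_)
  funext i
  refine Fin.lastCases ?_ (fun j => ?_) i
  · simp
  · refine Fin.lastCases ?_ (fun j' => ?_) j <;> simp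

/-- A structure is a model of the Baire scheme iff for every formula `φ(ȳ, x, t)` and all `ȳ`:
if the family `{x | φ(ȳ, x, t)}`, `t ∈ M`, covers `M` and is increasing then some member is
not nowhere dense. [cite: FornasieroServi2010, Def. 2.9] -/
theorem model_scheme_iff : M ⊨ scheme L ↔
    ∀ (m : ℕ) (φ : L.BoundedFormula Empty (m + 2)) (ys : Fin m → M),
      (∀ x, ∃ t, φ.Realize default (Fin.snoc (Fin.snoc ys x : Fin (m + 1) → M) t)) →
        (∀ x a b, a ≤ b → φ.Realize default (Fin.snoc (Fin.snoc ys x : Fin (m + 1) → M) a) →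
          φ.Realize default (Fin.snoc (Fin.snoc ys x : Fin (m + 1) → M) b)) →
          ∃ t, ¬ IsNowhereDense
            {x | φ.Realize default (Fin.snoc (Fin.snoc ys x : Fin (m + 1) → M) t)} := by
  simp only [Theory.model_iff, scheme, Set.mem_setOf_eq]
  constructor
  · intro h m φ
    exact (realize_sentence_iff φ).1 (h _ ⟨m, φ, rfl⟩)
  · rintro h σ ⟨m, φ, rfl⟩
    exact (realize_sentence_iff φ).2 (h m φ)

/-- **The models of the Baire scheme are exactly the definably Baire structures** (on a dense
linear order without endpoints carrying its order topology, `≤` interpreted by the order)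
(Fornasiero–Servi 2010, Remark 2.10: being Baire "can be expressed by a set of first-order
sentences").  The proof passes between formulas `φ(ȳ, x, t)` with variable parameters and
Mathlib's sets of pairs definable with finitely many parameters. [cite: FornasieroServi2010, Remark 2.10] -/
theorem model_scheme_iff_isDefinablyBaire : M ⊨ scheme L ↔ L.IsDefinablyBaire M := by
  classical
  constructor
  · intro h Y hY hnd hinc
    by_contra hcov
    push Not at hcov
    rw [Set.definable_iff_finitely_definable] at hY
    obtain ⟨A0, -, hA0⟩ := hY
    rw [Set.definable_iff_exists_formula_sum] at hA0
    obtain ⟨ψ, hψ⟩ := hA0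
    -- enumerate the finitely many parameters `A0` and turn them into bound variables `ȳ`
    set k := Fintype.card (A0 : Set M) with hk
    let e : (A0 : Set M) ≃ Fin k := Fintype.equivFin _
    let g : (A0 : Set M) ⊕ Fin 2 → Empty ⊕ Fin (k + 2) :=
      Sum.inr ∘ Sum.elim (Fin.castSucc ∘ Fin.castSucc ∘ e) ![Fin.last (k + 1), (Fin.last k).castSucc]
    let φ : L.BoundedFormula Empty (k + 2) := BoundedFormula.relabel g ψ
    let ys : Fin k → M := fun i => (e.symm i : M)
    have hS : ∀ t x, φ.Realize default (Fin.snoc (Fin.snoc ys x : Fin (k + 1) → M) t) ↔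
        (![t, x] : Fin 2 → M) ∈ Y := by
      intro t x
      have hx := congrArg (fun S : Set (Fin 2 → M) => (![t, x] : Fin 2 → M) ∈ S) hψ
      simp only [Set.mem_setOf_eq, eq_iff_iff] at hx
      rw [hx]
      simp only [φ]
      rw [BoundedFormula.realize_relabel, Formula.Realize]
      refine Iff.of_eq (congrArg₂ (BoundedFormula.Realize ψ) ?_ (Subsingleton.elim _ _))
      funext a
      rcases a with a | j
      · simp [g, ys]
      · fin_cases j <;> simp [g]
    obtain ⟨t, ht⟩ := (model_scheme_iff.1 h) k φ ys
      (fun x => by simpa only [hS] using hcov x)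
      (fun x a b hab ha => by rw [hS] at ha ⊢; exact hinc a b hab ha)
    refine ht ?_
    have hset : {x | φ.Realize default (Fin.snoc (Fin.snoc ys x : Fin (k + 1) → M) t)} =
        {x | (![t, x] : Fin 2 → M) ∈ Y} := by
      ext x; exact hS t x
    rw [hset]
    exact hnd t
  · intro h
    refine model_scheme_iff.2 fun m φ ys hcov hinc => ?_
    by_contra hnd
    push Not at hnd
    obtain ⟨x, hx⟩ := h _ (definable_setOf_realize_snoc_snoc φ ys)
      (fun t => by simpa using hnd t)
      (fun s t hst x hx => by
        simp only [Set.mem_setOf_eq, Matrix.cons_val_zero, Matrix.cons_val_one] at hx ⊢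
        exact hinc x s t hst hx)
    obtain ⟨t, ht⟩ := hcov x
    exact hx t (by simpa using ht)

/-- Models of the Baire scheme are definably Baire. [cite: FornasieroServi2010, Remark 2.10] -/
theorem isDefinablyBaire_of_model [M ⊨ scheme L] : L.IsDefinablyBaire M :=
  model_scheme_iff_isDefinablyBaire.1 ‹_›

/-- Definably Baire structures are models of the Baire scheme. [cite: FornasieroServi2010, Remark 2.10] -/
theorem model_scheme_of_isDefinablyBaire (h : L.IsDefinablyBaire M) : M ⊨ scheme L :=
  model_scheme_iff_isDefinablyBaire.2 h

/-- Every instance of the Baire scheme is true in a definably Baire structure: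
`scheme L ⊆ Th(M)`. [cite: FornasieroServi2010, Remark 2.10] -/
theorem scheme_subset_completeTheory (h : L.IsDefinablyBaire M) : scheme L ⊆ L.completeTheory M :=
  fun _ hσ => (Theory.model_iff _).1 (model_scheme_of_isDefinablyBaire h) _ hσ

end Models

end DefinableBaire

/-! ### The real exponential field -/

/-- `ℝ_exp` is definably Baire (as is every structure on `ℝ`). [cite: FornasieroServi2010, Examples 2.11] -/
theorem real_isDefinablyBaire : Language.orderedExpRing.IsDefinablyBaire ℝ :=
  isDefinablyBaire_real _

/-- `ℝ_exp` is a model of the Baire scheme of its language. [cite: FornasieroServi2010, Examples 2.11] -/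
instance Real.model_definableBaireScheme :
    ℝ ⊨ DefinableBaire.scheme Language.orderedExpRing :=
  DefinableBaire.model_scheme_of_isDefinablyBaire real_isDefinablyBaire

/-- **The Baire scheme is a set of axioms of `T_exp`**: every instance in the language
`(+, *, -, 0, 1, exp, ≤)` is true in `ℝ_exp` (the form in which it enters the recursively
axiomatized subtheories `[OF] + [DCB] + …` of Jones–Servi 2011, Def. 1.2, and Fornasiero–Servi
2010, Cor. 8.3). [cite: JonesServi2011, Def. 1.2] -/
theorem DefinableBaire.scheme_subset_realExpTheory :
    DefinableBaire.scheme Language.orderedExpRing ⊆ realExpTheory :=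
  DefinableBaire.scheme_subset_completeTheory real_isDefinablyBaire

/-- Likewise in the language of ordered rings. [cite: FornasieroServi2010, Examples 2.11] -/
theorem DefinableBaire.scheme_subset_realOrderedFieldTheory :
    DefinableBaire.scheme Language.orderedRing ⊆ realOrderedFieldTheory :=
  DefinableBaire.scheme_subset_completeTheory (isDefinablyBaire_real _)

/-- Every model of `T_exp = Th(ℝ_exp)` is a model of the Baire scheme. [folklore] -/
theorem model_definableBaireScheme_of_model_realExpTheory (N : Type*)
    [Language.orderedExpRing.Structure N] [N ⊨ realExpTheory] :
    N ⊨ DefinableBaire.scheme Language.orderedExpRing :=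
  Theory.Model.mono ‹_› DefinableBaire.scheme_subset_realExpTheory

end Literature.ModelTheory.ExponentialFields
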